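import Summits.Ventures.LatticeQCDFlow.Scoring.SchwingerDysonFreePropagator
import HarnessLib

/-!
# The two φ⁴ Schwinger–Dyson columns of `latflow.core` have population mean exactly zero under the joint Gibbs law

HONEST FRAMING: exact (Metropolis-corrected) sampling algorithms for lattice gauge theory;
figures of merit are autocorrelation/cost numbers at stated couplings and volumes; no
continuum-physics claim.  (SCALAR calibration rung S0-A: not a gauge result.)

Venture `LatticeQCDFlow` (cell pub-lqcd), sub-topic `Scoring`; FANOUT row 2 (`s0-phi4`).  NEW WORK
of the cell.  The engine `latflow.core` ≥ 0.2.5 (`schwinger_dyson.residual_phi4_2d`, row 9) writes,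
per stored configuration of a 2-d φ⁴ chain in the AKS 2019 normalisation
`S = Σ_x [Σ_μ (φ(x+μ) − φ_x)² + m² φ_x² + λ φ_x⁴]` with site force `g_x = ∂S/∂φ_x`, the two columns

  `obs_sd_virial = (1/V) Σ_x (1 − φ_x g_x)`,   `obs_sd_score = (1/V) Σ_x (2(4 + m²) + 12λ φ_x² − g_x²)`,

and the reader's rule of record (row 37, K0) treats `|z| > 3` on such a column as a finding.  This
file certifies the POPULATION statement the rule presupposes, for the JOINT Gibbs law
`e^{−S} dφ / Z` (not only for the one-site conditional law of `Exactness/Phi4SiteLaw.lean`): both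
columns have mean EXACTLY `0`, at every `λ > 0` and every real `m²` (incl. the tachyonic AKS 2019
sets `m² = −4`), on any enumerated periodic lattice `Fin (n+1)` with `d = |ι|` commuting or
non-commuting shift bijections `σ_μ` none of which fixes a site (every extent `L_μ ≥ 2`), and
also at `λ ≥ 0` when `m² > 0` (the free-field / T1 regime):

* `gibbs_virial_column`, `gibbs_virial_column_of_coercive` — `⟨Σ_x (1 − φ_x g_x)⟩ = 0`;
* `gibbs_score_column`, `gibbs_score_column_of_coercive` — `⟨Σ_x (2(2d + m²) + 12λφ_x² − g_x²)⟩ = 0`;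
* `…_mean` versions with the `1/V` normalisation, and `…_engine` versions with the force written
  out as `g_x = Σ_μ (4φ_x − 2φ(σ_μ x) − 2φ(σ_μ⁻¹ x)) + 2m²φ_x + 4λφ_x³` (`latticePhi4Force_shift`).

Everything is a finite linear combination (linearity lemmas of `…GibbsPolynomial.lean`) of the
per-site identities `gibbs_sd_pow_of_coercive` (`m = 1`) and `gibbs_score_residual_of_coercive`.

NOT here: the columns' variance / autocorrelation (what the `z` denominator estimates) and their
statistical power against planted defects (numerics gate).
-/

namespace Summit.Ventures.LatticeQCDFlow.Scoring

open Real MeasureTheory Set Filter Finset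

section Columns

variable {n : ℕ} {ι : Type*} [Fintype ι]

/-! ## The virial column -/

/-- **Virial column, coercive form**: `⟨Σ_x (1 − φ_x ∂S/∂φ_x)⟩ = 0` for any coupling matrix `J`
and real `λ` with `εΣφ² − K ≤ S`. -/
theorem gibbs_virial_column_of_coercive {J : Fin (n + 1) → Fin (n + 1) → ℝ} {lam ε K : ℝ}
    (hε : 0 < ε) (hS : ∀ φ : Fin (n + 1) → ℝ, ε * ∑ w, φ w ^ 2 - K ≤ latticePhi4Action J lam φ) :
    gibbsExpect J lam (fun φ => ∑ x, (1 - φ x * latticePhi4Force J lam φ x)) = 0 := by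
  have hZ := gibbsZ_pos_of_coercive hε hS
  have h1 : Integrable (fun φ : Fin (n + 1) → ℝ => (1 : ℝ) * gibbsWeight J lam φ) :=
    (integrable_gibbsWeight_of_coercive hε hS).const_mul 1 |>.congr
      (Eventually.of_forall fun φ => by simp)
  have hF : ∀ x, Integrable (fun φ : Fin (n + 1) → ℝ =>
      φ x * latticePhi4Force J lam φ x * gibbsWeight J lam φ) := by
    intro x
    refine (integrable_pow_mul_pow_mul_force_mul_gibbsWeight_of_coercive hε hS x x x 1 0).congr
      (Eventually.of_forall fun φ => ?_)
    simp only [pow_one, pow_zero, mul_one]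
  rw [gibbsExpect_sum J lam Finset.univ (fun x _ => (h1.sub (hF x)).congr
    (Eventually.of_forall fun φ => by simp only [Pi.sub_apply]; ring))]
  refine Finset.sum_eq_zero fun x _ => ?_
  rw [gibbsExpect_sub J lam h1 (hF x), gibbsExpect_const hZ]
  have h := gibbs_sd_pow_of_coercive hε hS x 1
  simp only [pow_one, Nat.cast_one, one_mul, Nat.sub_self, pow_zero] at h
  rw [h, gibbsExpect_const hZ, sub_self]

/-- **Virial column** (`λ > 0`, any real `J`): `⟨Σ_x (1 − φ_x ∂S/∂φ_x)⟩ = 0`. -/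
theorem gibbs_virial_column {lam : ℝ} (hlam : 0 < lam) (J : Fin (n + 1) → Fin (n + 1) → ℝ) :
    gibbsExpect J lam (fun φ => ∑ x, (1 - φ x * latticePhi4Force J lam φ x)) = 0 :=
  gibbs_virial_column_of_coercive one_pos (latticePhi4Action_coercive hlam J)

/-- **Virial column with the `1/V` normalisation** (`λ > 0`):
`⟨(1/V) Σ_x (1 − φ_x ∂S/∂φ_x)⟩ = 0`, `V = n + 1`. -/
theorem gibbs_virial_column_mean {lam : ℝ} (hlam : 0 < lam)
    (J : Fin (n + 1) → Fin (n + 1) → ℝ) :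
    gibbsExpect J lam (fun φ => (1 / (n + 1 : ℝ)) * ∑ x, (1 - φ x * latticePhi4Force J lam φ x))
      = 0 := by
  rw [gibbsExpect_const_mul, gibbs_virial_column hlam J, mul_zero]

/-- **Virial column in the engine's force convention** (`J = −Δ_lat + m²` via shifts `σ_μ`,
`λ > 0`, any real `m²`): `⟨Σ_x (1 − φ_x g_x)⟩ = 0` with
`g_x = Σ_μ (4φ_x − 2φ(σ_μ x) − 2φ(σ_μ⁻¹ x)) + 2m²φ_x + 4λφ_x³`. -/
theorem gibbs_virial_column_engine {lam : ℝ} (hlam : 0 < lam)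
    (σ : ι → Equiv.Perm (Fin (n + 1))) (m2 : ℝ) :
    gibbsExpect (shiftCoupling σ m2) lam (fun φ => ∑ x, (1 - φ x *
        ((∑ μ, (4 * φ x - 2 * φ (σ μ x) - 2 * φ ((σ μ).symm x))) + 2 * m2 * φ x
          + 4 * lam * φ x ^ 3))) = 0 := by
  have h := gibbs_virial_column hlam (shiftCoupling σ m2)
  simp only [latticePhi4Force_shift] at h
  exact h

/-! ## The score column -/

/-- **Score column, coercive form**: `⟨Σ_x (2J_{xx} + 12λφ_x² − (∂S/∂φ_x)²)⟩ = 0`. -/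
theorem gibbs_score_column_of_coercive {J : Fin (n + 1) → Fin (n + 1) → ℝ} {lam ε K : ℝ}
    (hε : 0 < ε) (hS : ∀ φ : Fin (n + 1) → ℝ, ε * ∑ w, φ w ^ 2 - K ≤ latticePhi4Action J lam φ) :
    gibbsExpect J lam (fun φ => ∑ x,
        (2 * J x x + 12 * lam * φ x ^ 2 - latticePhi4Force J lam φ x ^ 2)) = 0 := by
  have hw := integrable_gibbsWeight_of_coercive hε hS
  have hI : ∀ x, Integrable (fun φ : Fin (n + 1) → ℝ =>
      (2 * J x x + 12 * lam * φ x ^ 2 - latticePhi4Force J lam φ x ^ 2) * gibbsWeight J lam φ) := by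
    intro x
    have h2 := (integrable_pow_mul_pow_mul_gibbsWeight_of_coercive hε hS x x 2 0).const_mul
      (12 * lam)
    have h3 := integrable_force_sq_mul_gibbsWeight_of_coercive hε hS x
    refine (((hw.const_mul (2 * J x x)).add h2).sub h3).congr (Eventually.of_forall fun φ => ?_)
    simp only [Pi.add_apply, Pi.sub_apply, pow_zero, mul_one]
    ring
  rw [gibbsExpect_sum J lam Finset.univ (fun x _ => hI x)]
  exact Finset.sum_eq_zero fun x _ => gibbs_score_residual_of_coercive hε hS x

/-- **Score column** (`λ > 0`, any real `J`): `⟨Σ_x (2J_{xx} + 12λφ_x² − (∂S/∂φ_x)²)⟩ = 0`. -/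
theorem gibbs_score_column {lam : ℝ} (hlam : 0 < lam) (J : Fin (n + 1) → Fin (n + 1) → ℝ) :
    gibbsExpect J lam (fun φ => ∑ x,
        (2 * J x x + 12 * lam * φ x ^ 2 - latticePhi4Force J lam φ x ^ 2)) = 0 :=
  gibbs_score_column_of_coercive one_pos (latticePhi4Action_coercive hlam J)

/-- **Score column for the engine's action** (`λ > 0`, any real `m²`, shifts fixing no site):
`⟨Σ_x (2(2d + m²) + 12λφ_x² − g_x²)⟩ = 0`, `d = |ι|`; in `d = 2` the bracket is
`2(4 + m²) + 12λφ_x² − g_x²`, the `obs_sd_score` summand. -/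
theorem gibbs_score_column_shift {lam : ℝ} (hlam : 0 < lam)
    (σ : ι → Equiv.Perm (Fin (n + 1))) (m2 : ℝ) (hσ : ∀ μ x, σ μ x ≠ x) :
    gibbsExpect (shiftCoupling σ m2) lam (fun φ => ∑ x,
        (2 * (2 * Fintype.card ι + m2) + 12 * lam * φ x ^ 2
          - latticePhi4Force (shiftCoupling σ m2) lam φ x ^ 2)) = 0 := by
  have h := gibbs_score_column hlam (shiftCoupling σ m2)
  have hd : ∀ x, shiftCoupling σ m2 x x = 2 * Fintype.card ι + m2 :=
    fun x => shiftCoupling_diag σ m2 x (fun μ => hσ μ x)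
  simp only [hd] at h
  exact h

/-- **Score column with the `1/V` normalisation** for the engine's action (`λ > 0`):
`⟨(1/V) Σ_x (2(2d + m²) + 12λφ_x² − g_x²)⟩ = 0`. -/
theorem gibbs_score_column_shift_mean {lam : ℝ} (hlam : 0 < lam)
    (σ : ι → Equiv.Perm (Fin (n + 1))) (m2 : ℝ) (hσ : ∀ μ x, σ μ x ≠ x) :
    gibbsExpect (shiftCoupling σ m2) lam (fun φ => (1 / (n + 1 : ℝ)) * ∑ x,
        (2 * (2 * Fintype.card ι + m2) + 12 * lam * φ x ^ 2
          - latticePhi4Force (shiftCoupling σ m2) lam φ x ^ 2)) = 0 := by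
  rw [gibbsExpect_const_mul, gibbs_score_column_shift hlam σ m2 hσ, mul_zero]

/-- **Score column in the engine's force convention** (`λ > 0`, any real `m²`, shifts fixing no
site): `⟨Σ_x (2(2d + m²) + 12λφ_x² − g_x²)⟩ = 0` with
`g_x = Σ_μ (4φ_x − 2φ(σ_μ x) − 2φ(σ_μ⁻¹ x)) + 2m²φ_x + 4λφ_x³` written out. -/
theorem gibbs_score_column_engine {lam : ℝ} (hlam : 0 < lam)
    (σ : ι → Equiv.Perm (Fin (n + 1))) (m2 : ℝ) (hσ : ∀ μ x, σ μ x ≠ x) :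
    gibbsExpect (shiftCoupling σ m2) lam (fun φ => ∑ x,
        (2 * (2 * Fintype.card ι + m2) + 12 * lam * φ x ^ 2
          - ((∑ μ, (4 * φ x - 2 * φ (σ μ x) - 2 * φ ((σ μ).symm x))) + 2 * m2 * φ x
              + 4 * lam * φ x ^ 3) ^ 2)) = 0 := by
  have h := gibbs_score_column_shift hlam σ m2 hσ
  simp only [latticePhi4Force_shift] at h
  exact h

/-! ## The free-field / positive-mass regime `m² > 0`, `λ ≥ 0` -/

/-- **Virial column at `m² > 0`, `λ ≥ 0`** (incl. the Gaussian T1 regime `λ = 0`): the engine's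
action is coercive with `ε = m²` (`shiftCoupling_coercive_of_pos_mass`), so `⟨Σ_x (1 − φ_x g_x)⟩ = 0`. -/
theorem gibbs_virial_column_of_pos_mass (σ : ι → Equiv.Perm (Fin (n + 1))) {m2 lam : ℝ}
    (hm2 : 0 < m2) (hlam : 0 ≤ lam) :
    gibbsExpect (shiftCoupling σ m2) lam (fun φ => ∑ x,
        (1 - φ x * latticePhi4Force (shiftCoupling σ m2) lam φ x)) = 0 :=
  gibbs_virial_column_of_coercive hm2 (shiftCoupling_coercive_of_pos_mass σ hlam)

/-- **Score column at `m² > 0`, `λ ≥ 0`**, shifts fixing no site: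
`⟨Σ_x (2(2d + m²) + 12λφ_x² − g_x²)⟩ = 0` (at `λ = 0`: `⟨g_x²⟩ = 2(2d + m²)`, the Gaussian score). -/
theorem gibbs_score_column_of_pos_mass (σ : ι → Equiv.Perm (Fin (n + 1))) {m2 lam : ℝ}
    (hm2 : 0 < m2) (hlam : 0 ≤ lam) (hσ : ∀ μ x, σ μ x ≠ x) :
    gibbsExpect (shiftCoupling σ m2) lam (fun φ => ∑ x,
        (2 * (2 * Fintype.card ι + m2) + 12 * lam * φ x ^ 2
          - latticePhi4Force (shiftCoupling σ m2) lam φ x ^ 2)) = 0 := by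
  have h := gibbs_score_column_of_coercive hm2 (shiftCoupling_coercive_of_pos_mass σ hlam)
  have hd : ∀ x, shiftCoupling σ m2 x x = 2 * Fintype.card ι + m2 :=
    fun x => shiftCoupling_diag σ m2 x (fun μ => hσ μ x)
  simp only [hd] at h
  exact h

end Columns

end Summit.Ventures.LatticeQCDFlow.Scoring
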